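import Mathlib
import Summits.KontsevichZagierPeriods.Zeta5Search.BrickResidueLawCirc
import Summits.KontsevichZagierPeriods.Zeta5Search.BrickLambdaLocality

/-!
# BrickBonusResidueLaw — the ° residue law and the digit-locality of the ° multiplier WITH THE CARRY BONUS KEPT:
error `≤ exp(−(L + m))` and `λ_{j'} ≡ λ_j (mod p^{m' + e − 1})`, `m = B c_a + B c_b + ε c_c` (cell zeta5-irr)

HONEST FRAMING: systematic search; no irrationality claim unless certified. INSTRUMENT lemmas of the ζ(5)
census cell zeta5-irr (HOME `run/shared/lean/pub/zeta5-irr/`), filed by the engine seat zi-eng (g12); first of the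
files typing Krattenthaler–Rivoal's Théorème 5 bonus `Φ̃_n^{B−1}` (Mem. AMS 875 (2007) §3) at odd primes by the cell's
`p`-adic route (roadmap `zi-eng/lean-g12/FINDINGS-g12.md` §3, steps P4–P5). Nothing here is about ζ(5); no irrationality
content; 0 nats/n; rung F-Z1 NOT moved. WHAT THIS IS NOT: not yet a denominator statement — these are the two sharpened
inputs (the reduction and the corollaries follow in `BrickBonusWeights`, `BrickBonusReduction`).

## The point

For a ° cell `j = j₀ + Jp` of the row `n = n₀ + Np` (`j₀ ≤ n₀ < p`) the chain's multiplier `λ_j = c_{j,A}(n)/c̃_{J,A}(N)`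
has `v_p(λ_j) = m` EXACTLY off the centre, `m = B·c_a + B·c_b + ε·c_c` with the bottom-digit CARRIES
`c_a = ⌊(n₀+j₀)/p⌋`, `c_b = ⌊(2n₀−j₀)/p⌋` (Kummer for `C(n+j,n)`, `C(2n−j,n)` — Krattenthaler–Rivoal's Lemme 8) and the
centre carry `c_c` (`BrickLambdaCirc`, `BrickResidueLawCirc.lambda_circ`). The chain's residue law and locality lemma
discard this `m` (they keep `exp(−(L+1))`, `exp(−e)`); here it is KEPT:

* **`residueLaw_circ_depth_bonus`** (every level `L`, every depth `d`, `p` odd, `2B ≤ A`):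
  `v(p^{(L+1)d}·[T^d]F_j − λ_j·p^{Ld}·[T^d]F̃_J) ≤ exp(−(L + m))` — because the strip constant `a` of
  `rescale_p F_j = F̃_J·(a·E_j·U)` has `v(a) = m` exactly (`BrickLambdaCirc.padicValuation_stripConst`), so EVERY
  coefficient of `W = a·E_j·U` lies in `p^m ℤ_(p)` (the chain's `strip_coeff_le` records only `pℤ_(p)`).
* `gainPart_eq_pow_mul`: the gained part of `BrickLambdaClosedForm` is `Y_j = p^{m'}·Z_j` EXPLICITLY, `m' = B c_a + B c_b`;
  `gainCore_zmod_eq`: `Z_{j'} ≡ Z_j (mod p^{e−1})` for `j' = j + p^e q`; `gainPart_sub_bonus`: `v(Y_{j'} − Y_j) ≤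
  exp(−(m' + e − 1))`; `padicValuation_gainPart_le`: `v(Y_j) ≤ exp(−m')`;
* **`lambda_digit_local_bonus`**: `v(λ_{j'} − λ_j) ≤ exp(−(m' + e − 1))` for `j' = j + p^e q`, `e ≥ 1`
  (`BrickLambdaLocality.lambda_digit_local`: `exp(−e)`, the case `m' = 0`) — three-term split
  `(c'^ε − c^ε)Y'U + c^ε(Y' − Y)U + c^εY(U − U')` of the closed form `λU = σ(n/2−j)^εY`.
-/

namespace Summit.KontsevichZagierPeriods.Zeta5Search.BrickBonusResidueLaw

open Finset Nat Polynomial WithZero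
open Summit.KontsevichZagierPeriods.Zeta5Search.BrickTopCoefficient (cTop)
open Summit.KontsevichZagierPeriods.Zeta5Search.BrickLaurent (laurent cell laurent_zero)
open Summit.KontsevichZagierPeriods.Zeta5Search.BrickPartialFractions (cellZero)
open Summit.KontsevichZagierPeriods.Zeta5Search.ScaledSeries (IsSlopeInt)
open Summit.KontsevichZagierPeriods.Zeta5Search.BrickLambda (cTop_zero_ne_zero)
open Summit.KontsevichZagierPeriods.Zeta5Search.BrickResidueLawMain (level_laurent_integral)
open Summit.KontsevichZagierPeriods.Zeta5Search.BrickDigitStripCirc (centreCarry carryPoly laurent_rescale_eq_sum_circ)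
open Summit.KontsevichZagierPeriods.Zeta5Search.BrickLambdaCirc (padicValuation_stripConst)
open Summit.KontsevichZagierPeriods.Zeta5Search.BrickResidueLawCirc (padicValuation_coeff_carryPoly_le)
open Summit.KontsevichZagierPeriods.Zeta5Search.BrickLambda (padicValuation_two)
open Summit.KontsevichZagierPeriods.Zeta5Search.GaussWilsonBlock (unitFactorial unitFactorial_shift_iter)
open Summit.KontsevichZagierPeriods.Zeta5Search.BrickLambdaClosedForm (unitPart gainPart padicValuation_unitPart
  lambda_mul_unitPart padicValuation_unitFactorial)
open Summit.KontsevichZagierPeriods.Zeta5Search.BrickLambdaLocality (cong_pow_le padicValuation_sub_le_of_zmod_eq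
  sub_shift unitPart_zmod_eq)
open Literature.NumberTheory.LFunctions (padicValuation_natCast_le_one)

noncomputable section

variable {p : ℕ} [Fact p.Prime]

section circ

variable (hp2 : p ≠ 2) {A B ε N n₀ J j₀ n j L : ℕ} (hAB : 2 * B ≤ A) (hn : n = n₀ + N * p) (hj : j = j₀ + J * p)
  (hN : N < p ^ (L + 1)) (hn₀ : n₀ < p) (hj₀ : j₀ ≤ n₀) (hJN : J ≤ N) (hcen : 2 * j ≠ n ∨ ε = 0)
include hp2 hAB hn hj hN hn₀ hj₀ hJN hcen

/-- **The ° residue law with the carry bonus KEPT** (every level, every depth `d`): for a ° cell `j = j₀ + Jp` of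
`n = n₀ + Np` with carry count `m = B·c_a + B·c_b + ε·c_c` (`c_a = ⌊(n₀+j₀)/p⌋`, `c_b = ⌊(2n₀−j₀)/p⌋`,
`c_c` the centre carry) and any `λ` with `λ·c̃_{J,A}(N) = c_{j,A}(n)`:
`v(p^{(L+1)d}·[T^d]F_j − λ·p^{Ld}·[T^d]F̃_J) ≤ exp(−(L + m))` (for `m = 0` this is weaker than
`BrickResidueLawCirc.residueLaw_circ_depth`'s `exp(−(L+1))`, for `m ≥ 2` stronger). The constant
`a` of the strip identity has `v(a) = exp(−m)` EXACTLY (`padicValuation_stripConst`), so EVERY coefficient of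
`W = a·E_j·U` lies in `p^m ℤ_(p)`. -/
theorem residueLaw_circ_depth_bonus {lam : ℚ} (hmul : lam * cTop A B 0 N J = cTop A B ε n j) (d : ℕ) :
    Rat.padicValuation p ((p : ℚ) ^ ((L + 1) * d) * laurent A B ε n j d -
      lam * ((p : ℚ) ^ (L * d) * laurent A B 0 N J d)) ≤
      exp (-((L : ℤ) + (B * ((n₀ + j₀) / p) + B * ((n₀ + (n₀ - j₀)) / p) + ε * centreCarry p n j : ℕ))) := by
  have hp : p.Prime := Fact.out
  subst hn hj
  set m : ℕ := B * ((n₀ + j₀) / p) + B * ((n₀ + (n₀ - j₀)) / p) + ε * centreCarry p (n₀ + N * p) (j₀ + J * p)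
    with hm_def
  obtain ⟨U, hU0, hUint, a, hsum, hlam⟩ :=
    laurent_rescale_eq_sum_circ (p := p) hp2 (A := A) (B := B) (ε := ε) hn₀ hj₀ hJN rfl rfl
  have hva : Rat.padicValuation p a = exp (-(m : ℤ)) :=
    padicValuation_stripConst (p := p) hp2 hn₀ hj₀ hJN hAB rfl rfl hcen hlam
  have hjn : j₀ + J * p ≤ n₀ + N * p := by nlinarith
  set E : ℚ[X] := carryPoly p B ε N n₀ J j₀ with hE
  -- the series `W = a·E·U` and its coefficients: ALL in `p^m ℤ_(p)`
  set w : ℕ → ℚ := fun g => a * PowerSeries.coeff g ((E : PowerSeries ℚ) * U) with hw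
  have hw0 : w 0 = lam := by
    rw [laurent_zero hAB 0 hJN, laurent_zero hAB ε hjn, ← hmul] at hlam
    rw [hw]
    simp only
    rw [PowerSeries.coeff_zero_eq_constantCoeff_apply, map_mul, hU0, mul_one, Polynomial.constantCoeff_coe,
      coeff_zero_eq_eval_zero]
    exact mul_right_cancel₀ (cTop_zero_ne_zero hJN A B) hlam
  have hwg : ∀ g, Rat.padicValuation p (w g) ≤ exp (-(m : ℤ)) := by
    intro g
    rw [hw]
    simp only
    rw [PowerSeries.coeff_mul, Finset.mul_sum]
    refine Valuation.map_sum_le _ fun x hx => ?_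
    rw [← mul_assoc, map_mul, map_mul, Polynomial.coeff_coe, hva]
    have hU2 : Rat.padicValuation p (PowerSeries.coeff x.2 U) ≤ 1 :=
      (hUint x.2).trans (by rw [← exp_zero, exp_le_exp]; nlinarith [Int.natCast_nonneg x.2])
    calc _ ≤ exp (-(m : ℤ)) * 1 * 1 :=
        mul_le_mul' (mul_le_mul' le_rfl (padicValuation_coeff_carryPoly_le hp2 _ _ _ _ _ _ _)) hU2
      _ = _ := by rw [mul_one, mul_one]
  -- `p^{Lg}·[T^g]W` pays `p^{L+m}` for `g ≥ 1`
  have hW : ∀ g, 1 ≤ g → Rat.padicValuation p ((p : ℚ) ^ (L * g) * w g) ≤ exp (-((L : ℤ) + m)) := by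
    intro g hg
    have hg1 : (1 : ℤ) ≤ g := by exact_mod_cast hg
    rw [map_mul, map_pow, Rat.padicValuation_self, ← exp_nsmul]
    refine (mul_le_mul' le_rfl (hwg g)).trans ?_
    rw [← exp_add, exp_le_exp, nsmul_eq_mul]
    push_cast
    nlinarith [mul_nonneg (Int.natCast_nonneg L) (sub_nonneg.2 hg1)]
  -- the two-scale expansion with the `g = 0` term split off (verbatim from `residueLaw_circ_depth`)
  rw [← hw0]
  set S : ℚ := ∑ k ∈ range d, laurent A B 0 N J k * w (d - k) with hS
  have hd : (p : ℚ) ^ d * laurent A B ε (n₀ + N * p) (j₀ + J * p) d = S + laurent A B 0 N J d * w 0 := by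
    rw [hsum d, Finset.mul_sum]
    have : ∀ x ∈ antidiagonal d, a * (laurent A B 0 N J x.1 * PowerSeries.coeff x.2 ((E : PowerSeries ℚ) * U)) =
        laurent A B 0 N J x.1 * w x.2 := fun x _ => by rw [hw]; ring
    rw [Finset.sum_congr rfl this, Finset.Nat.sum_antidiagonal_eq_sum_range_succ
      (fun e g => laurent A B 0 N J e * w g) d, Finset.sum_range_succ, Nat.sub_self]
  have hPS : (p : ℚ) ^ (L * d) * S =
      ∑ k ∈ range d, ((p : ℚ) ^ (L * k) * laurent A B 0 N J k) * ((p : ℚ) ^ (L * (d - k)) * w (d - k)) := by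
    rw [hS, Finset.mul_sum]
    refine Finset.sum_congr rfl fun k hk => ?_
    have hk' := mem_range.1 hk
    rw [show L * d = L * k + L * (d - k) by rw [← mul_add]; congr 1; omega, pow_add]
    ring
  rw [show (p : ℚ) ^ ((L + 1) * d) * laurent A B ε (n₀ + N * p) (j₀ + J * p) d =
      (p : ℚ) ^ (L * d) * ((p : ℚ) ^ d * laurent A B ε (n₀ + N * p) (j₀ + J * p) d) by
      rw [show (L + 1) * d = L * d + d by ring, pow_add, mul_assoc], hd,
    show (p : ℚ) ^ (L * d) * (S + laurent A B 0 N J d * w 0) - w 0 * ((p : ℚ) ^ (L * d) * laurent A B 0 N J d) =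
      (p : ℚ) ^ (L * d) * S by ring, hPS]
  refine Valuation.map_sum_le _ fun k hk => ?_
  have hk' := mem_range.1 hk
  rw [map_mul]
  calc _ ≤ 1 * exp (-((L : ℤ) + m)) := mul_le_mul' (level_laurent_integral hp2 hAB hN hJN k) (hW (d - k) (by omega))
    _ = _ := one_mul _

end circ

/-! ## DIGIT-LOCALITY of the ° multiplier with the carry bonus kept: `λ_{j'} ≡ λ_j (mod p^{m' + e − 1})` -/

section locality

variable (hp2 : p ≠ 2) {A B j₀ m₀ J M J' M' e q : ℕ} (hJM : J' + M' = J + M) (hq : J' * p = J * p + p ^ e * q)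
  (he : 1 ≤ e)
include hp2 hJM hq he

omit [Fact p.Prime] hp2 hJM hq he in
/-- **The gained part carries `p^{m'}` EXPLICITLY**: `Y_j = p^{B c_a + B c_b}·Z_j` with
`Z_j = (n!_p)^A·(y_a^{c_a}(n+j)!_p)^B·(y_b^{c_b}(2n−j)!_p)^B` (`y_a = N+J+1`, `y_b = 2N−J+1`). -/
theorem gainPart_eq_pow_mul (J M : ℕ) : gainPart p A B j₀ m₀ J M =
    p ^ (B * ((j₀ + m₀ + j₀) / p) + B * ((j₀ + m₀ + m₀) / p)) *
      (unitFactorial p (j₀ + m₀ + (J + M) * p) ^ A *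
        ((J + M + J + 1) ^ ((j₀ + m₀ + j₀) / p) * unitFactorial p (j₀ + m₀ + (J + M) * p + (j₀ + J * p))) ^ B *
        ((J + M + M + 1) ^ ((j₀ + m₀ + m₀) / p) * unitFactorial p (m₀ + M * p + (j₀ + m₀ + (J + M) * p))) ^ B) := by
  unfold gainPart
  simp only [mul_pow, ← pow_mul]
  ring

omit hp2 in
/-- The digit shift at the level of `J`: `J' = J + p^{e−1}q` and `M = M' + p^{e−1}q`. -/
theorem digit_shift : J' = J + p ^ (e - 1) * q ∧ M = M' + p ^ (e - 1) * q := by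
  have hp : p.Prime := Fact.out
  have hMq := sub_shift hJM hq
  have hpe : p ^ e = p ^ (e - 1) * p := by rw [← pow_succ]; congr 1; omega
  constructor
  · apply Nat.eq_of_mul_eq_mul_right hp.pos
    rw [hq, hpe]; ring
  · apply Nat.eq_of_mul_eq_mul_right hp.pos
    rw [hMq, hpe]; ring

/-- **The cores agree mod `p^{e−1}`**: `Z_{j'} ≡ Z_j (mod p^{e−1})` (`y`'s move by `p^{e−1}q`, the unit factorials by
`p^e q = p^{e−1}(pq)` with signs `(−1)^{pq}` cancelling in pairs). -/
theorem gainCore_zmod_eq :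
    ((unitFactorial p (j₀ + m₀ + (J' + M') * p) ^ A *
        ((J' + M' + J' + 1) ^ ((j₀ + m₀ + j₀) / p) * unitFactorial p (j₀ + m₀ + (J' + M') * p + (j₀ + J' * p))) ^ B *
        ((J' + M' + M' + 1) ^ ((j₀ + m₀ + m₀) / p) * unitFactorial p (m₀ + M' * p + (j₀ + m₀ + (J' + M') * p))) ^ B
          : ℕ) : ZMod (p ^ (e - 1))) =
      ((unitFactorial p (j₀ + m₀ + (J + M) * p) ^ A *
        ((J + M + J + 1) ^ ((j₀ + m₀ + j₀) / p) * unitFactorial p (j₀ + m₀ + (J + M) * p + (j₀ + J * p))) ^ B *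
        ((J + M + M + 1) ^ ((j₀ + m₀ + m₀) / p) * unitFactorial p (m₀ + M * p + (j₀ + m₀ + (J + M) * p))) ^ B
          : ℕ) : ZMod (p ^ (e - 1))) := by
  have hp : p.Prime := Fact.out
  have h3 : 3 ≤ p := by have := hp.two_le; omega
  obtain ⟨hJ', hM⟩ := digit_shift (p := p) hJM hq he
  rcases Nat.lt_or_ge e 2 with he1 | he2
  · -- `e = 1`: `ZMod (p^0) = ZMod 1` is trivial
    have he0 : e - 1 = 0 := by omega
    rw [he0, pow_zero]
    exact Subsingleton.elim _ _
  · have he' : 1 ≤ e - 1 := by omega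
    have hpe : ((p : ZMod (p ^ (e - 1))) ^ (e - 1)) = 0 := by rw [← Nat.cast_pow, ZMod.natCast_self]
    have s3 : (unitFactorial p (j₀ + m₀ + (J + M) * p + (j₀ + J' * p)) : ZMod (p ^ (e - 1))) =
        (-1) ^ (p * q) * unitFactorial p (j₀ + m₀ + (J + M) * p + (j₀ + J * p)) := by
      rw [show j₀ + m₀ + (J + M) * p + (j₀ + J' * p) = (j₀ + m₀ + (J + M) * p + (j₀ + J * p)) + p ^ (e - 1) * (p * q) by
        rw [hJ']; ring, unitFactorial_shift_iter p (e - 1) _ (p * q) hp h3 he']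
    have s4 : (unitFactorial p (m₀ + M * p + (j₀ + m₀ + (J + M) * p)) : ZMod (p ^ (e - 1))) =
        (-1) ^ (p * q) * unitFactorial p (m₀ + M' * p + (j₀ + m₀ + (J + M) * p)) := by
      rw [show m₀ + M * p + (j₀ + m₀ + (J + M) * p) = (m₀ + M' * p + (j₀ + m₀ + (J + M) * p)) + p ^ (e - 1) * (p * q) by
        rw [hM]; ring, unitFactorial_shift_iter p (e - 1) _ (p * q) hp h3 he']
    have hJc : (J' : ZMod (p ^ (e - 1))) = (J : ZMod (p ^ (e - 1))) := by
      rw [hJ']; push_cast; rw [hpe, zero_mul, add_zero]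
    have hMc : (M : ZMod (p ^ (e - 1))) = (M' : ZMod (p ^ (e - 1))) := by
      rw [hM]; push_cast; rw [hpe, zero_mul, add_zero]
    rw [hJM]
    push_cast
    rw [s3, s4]
    simp only [hJc, hMc]
    ring

/-- **The gained parts agree mod `p^{m' + e − 1}`**: `v(Y_{j'} − Y_j) ≤ exp(−(m' + (e−1)))`. -/
theorem gainPart_sub_bonus :
    Rat.padicValuation p ((gainPart p A B j₀ m₀ J' M' : ℚ) - gainPart p A B j₀ m₀ J M) ≤
      exp (-((B * ((j₀ + m₀ + j₀) / p) + B * ((j₀ + m₀ + m₀) / p) + (e - 1) : ℕ) : ℤ)) := by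
  rw [gainPart_eq_pow_mul (p := p) (A := A) (B := B) (j₀ := j₀) (m₀ := m₀) J' M',
    gainPart_eq_pow_mul (p := p) (A := A) (B := B) (j₀ := j₀) (m₀ := m₀) J M]
  push_cast
  rw [← mul_sub, map_mul, map_pow, Rat.padicValuation_self, ← exp_nsmul, nsmul_eq_mul, mul_neg_one]
  have hZ := padicValuation_sub_le_of_zmod_eq (p := p)
    (gainCore_zmod_eq (A := A) (B := B) (j₀ := j₀) (m₀ := m₀) hp2 hJM hq he)
  push_cast at hZ
  refine (mul_le_mul' le_rfl hZ).trans ?_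
  rw [← exp_add, exp_le_exp]
  push_cast
  omega

omit hp2 hJM hq he in
/-- `v(Y_j) ≤ exp(−m')`: the gained part is divisible by `p^{m'}`. -/
theorem padicValuation_gainPart_le (J M : ℕ) : Rat.padicValuation p (gainPart p A B j₀ m₀ J M : ℚ) ≤
    exp (-((B * ((j₀ + m₀ + j₀) / p) + B * ((j₀ + m₀ + m₀) / p) : ℕ) : ℤ)) := by
  rw [gainPart_eq_pow_mul (p := p) (A := A) (B := B) (j₀ := j₀) (m₀ := m₀) J M]
  push_cast
  rw [map_mul, map_pow, Rat.padicValuation_self, ← exp_nsmul, nsmul_eq_mul, mul_neg_one]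
  calc _ ≤ exp (-((B * ((j₀ + m₀ + j₀) / p) + B * ((j₀ + m₀ + m₀) / p) : ℕ) : ℤ)) * 1 :=
        mul_le_mul' le_rfl (by exact_mod_cast padicValuation_natCast_le_one (p := p) _)
    _ = _ := mul_one _

/-- **DIGIT-LOCALITY WITH THE CARRY BONUS** (° cells, `A` even, odd `p`): for `j = j₀ + Jp`, `j' = j + p^e q` (`e ≥ 1`)
in the row `n = n₀ + Np` and `λ, λ'` the multipliers: `v(λ' − λ) ≤ exp(−(m' + e − 1))`, `m' = B c_a + B c_b` —
`BrickLambdaLocality.lambda_digit_local` gives `exp(−e)` (the case `m' = 0`); the gain comes from `Y = p^{m'}·Z`. -/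
theorem lambda_digit_local_bonus (hA : Even A) (hn₀ : j₀ + m₀ < p) {ε : ℕ} {lam lam' : ℚ}
    (hlam : lam * cTop A B 0 (J + M) J = cTop A B ε (j₀ + m₀ + (J + M) * p) (j₀ + J * p))
    (hlam' : lam' * cTop A B 0 (J' + M') J' = cTop A B ε (j₀ + m₀ + (J' + M') * p) (j₀ + J' * p)) :
    Rat.padicValuation p (lam' - lam) ≤
      exp (-((B * ((j₀ + m₀ + j₀) / p) + B * ((j₀ + m₀ + m₀) / p) + (e - 1) : ℕ) : ℤ)) := by
  have hp : p.Prime := Fact.out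
  set m' : ℕ := B * ((j₀ + m₀ + j₀) / p) + B * ((j₀ + m₀ + m₀) / p) with hm'
  have hL := lambda_mul_unitPart (p := p) (A := A) (B := B) (ε := ε) hn₀ hlam
  have hL' := lambda_mul_unitPart (p := p) (A := A) (B := B) (ε := ε) hn₀ hlam'
  have hsgn : ∀ x y N : ℕ, ((-1 : ℚ) ^ ((j₀ + m₀ + (J + M) * p) * B + x * A)) * (-1) ^ (N * B + y * A) =
      (-1) ^ ((j₀ + m₀ + (J + M) * p) * B) * (-1) ^ (N * B) := by
    intro x y N
    rw [pow_add, pow_add, (hA.mul_left x).neg_one_pow, (hA.mul_left y).neg_one_pow, mul_one, mul_one]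
  rw [hsgn] at hL
  rw [hJM, hsgn] at hL'
  set σ : ℚ := (-1) ^ ((j₀ + m₀ + (J + M) * p) * B) * (-1) ^ ((J + M) * B) with hσ
  set c : ℚ := (((j₀ + m₀ + (J + M) * p : ℕ) : ℚ) / 2 - ((j₀ + J * p : ℕ) : ℚ)) with hc
  set c' : ℚ := (((j₀ + m₀ + (J + M) * p : ℕ) : ℚ) / 2 - ((j₀ + J' * p : ℕ) : ℚ)) with hc'
  set Y : ℚ := (gainPart p A B j₀ m₀ J M : ℚ) with hY
  set Y' : ℚ := (gainPart p A B j₀ m₀ J' M' : ℚ) with hY'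
  set U : ℚ := (unitPart p A B j₀ m₀ J M : ℚ) with hU
  set U' : ℚ := (unitPart p A B j₀ m₀ J' M' : ℚ) with hU'
  have vU : Rat.padicValuation p U = 1 := padicValuation_unitPart (p := p) A B j₀ m₀ J M
  have vU' : Rat.padicValuation p U' = 1 := padicValuation_unitPart (p := p) A B j₀ m₀ J' M'
  have hU0 : U ≠ 0 := fun h => by rw [h, map_zero] at vU; exact zero_ne_one vU
  have hU'0 : U' ≠ 0 := fun h => by rw [h, map_zero] at vU'; exact zero_ne_one vU'
  have vUU : Rat.padicValuation p (U - U') ≤ exp (-(e : ℤ)) := by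
    rw [Valuation.map_sub_swap]; exact padicValuation_sub_le_of_zmod_eq (unitPart_zmod_eq hp2 hJM hq he)
  have vYY : Rat.padicValuation p (Y' - Y) ≤ exp (-((m' + (e - 1) : ℕ) : ℤ)) :=
    gainPart_sub_bonus (A := A) (B := B) (j₀ := j₀) (m₀ := m₀) hp2 hJM hq he
  have vY : Rat.padicValuation p Y ≤ exp (-(m' : ℤ)) := padicValuation_gainPart_le (p := p) J M
  have vY' : Rat.padicValuation p Y' ≤ exp (-(m' : ℤ)) := padicValuation_gainPart_le (p := p) J' M'
  have hcen : ∀ x : ℕ, Rat.padicValuation p ((((j₀ + m₀ + (J + M) * p : ℕ) : ℚ)) / 2 - (x : ℚ)) ≤ 1 := by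
    intro x
    rw [show (((j₀ + m₀ + (J + M) * p : ℕ) : ℚ)) / 2 - (x : ℚ) = ((((j₀ + m₀ + (J + M) * p : ℕ) : ℤ) - 2 * x : ℤ) : ℚ) / 2
      by push_cast; ring, map_div₀, padicValuation_two hp2, div_one, Rat.padicValuation_cast]
    exact Int.padicValuation_le_one _ _
  have hc1 : Rat.padicValuation p c ≤ 1 := by rw [hc]; exact_mod_cast hcen (j₀ + J * p)
  have hc'1 : Rat.padicValuation p c' ≤ 1 := by rw [hc']; exact_mod_cast hcen (j₀ + J' * p)
  have hcc : Rat.padicValuation p (c' - c) ≤ exp (-(e : ℤ)) := by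
    have : c' - c = -((p : ℚ) ^ e * q) := by
      have hq' : ((j₀ + J' * p : ℕ) : ℚ) = ((j₀ + J * p : ℕ) : ℚ) + (p : ℚ) ^ e * q := by
        exact_mod_cast (by rw [hq]; ring : j₀ + J' * p = j₀ + J * p + p ^ e * q)
      rw [hc, hc', hq']; ring
    rw [this, Valuation.map_neg, map_mul, map_pow, Rat.padicValuation_self, ← exp_nsmul, nsmul_eq_mul, mul_neg_one]
    calc _ ≤ exp (-(e : ℤ)) * 1 := mul_le_mul' le_rfl (padicValuation_natCast_le_one q)
      _ = _ := mul_one _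
  have hσv : Rat.padicValuation p σ = 1 := by
    rw [hσ, map_mul, map_pow, map_pow, Valuation.map_neg, map_one, one_pow, one_pow, mul_one]
  have hlamq : lam = σ * c ^ ε * Y / U := by rw [eq_div_iff hU0, hL]
  have hlamq' : lam' = σ * c' ^ ε * Y' / U' := by rw [eq_div_iff hU'0, hL']
  -- three-term split: `(c'^ε − c^ε)Y'U + c^ε(Y' − Y)U + c^εY(U − U')`
  rw [hlamq', hlamq, div_sub_div _ _ hU'0 hU0, map_div₀, map_mul, vU, vU', mul_one, div_one,
    show σ * c' ^ ε * Y' * U - U' * (σ * c ^ ε * Y) =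
      σ * ((c' ^ ε - c ^ ε) * Y' * U + c ^ ε * (Y' - Y) * U + c ^ ε * Y * (U - U')) by ring, map_mul, hσv, one_mul]
  have hcε : Rat.padicValuation p (c ^ ε) ≤ 1 := by rw [map_pow]; exact pow_le_one' hc1 ε
  have hgoal : (-((m' + (e - 1) : ℕ) : ℤ)) = -(m' : ℤ) + (-(e : ℤ) + 1) := by push_cast [Nat.cast_sub he]; ring
  refine (Valuation.map_add_le _ (Valuation.map_add_le _ ?_ ?_) ?_)
  · rw [map_mul, map_mul, vU, mul_one]
    refine (mul_le_mul' (cong_pow_le hcc hc'1 hc1 ε) vY').trans ?_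
    rw [← exp_add, exp_le_exp]; omega
  · rw [map_mul, map_mul, vU, mul_one]
    calc _ ≤ 1 * exp (-((m' + (e - 1) : ℕ) : ℤ)) := mul_le_mul' hcε vYY
      _ = _ := one_mul _
  · rw [map_mul, map_mul]
    calc _ ≤ 1 * exp (-(m' : ℤ)) * exp (-(e : ℤ)) := mul_le_mul' (mul_le_mul' hcε vY) vUU
      _ ≤ _ := by rw [one_mul, ← exp_add, exp_le_exp]; omega

end locality

end

end Summit.KontsevichZagierPeriods.Zeta5Search.BrickBonusResidueLaw
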